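import Literature.NumberTheory.EllipticCurves.Gamma0CosetP1
import Literature.NumberTheory.EllipticCurves.HeckeTnGamma0Explicit
import Literature.NumberTheory.EllipticCurves.ModularSymbolsParabolicCohomologyProofs
import HarnessLib

/-!
# The Hecke operators on M-symbols: `2 [q]_{T_n f} = ∑_M ξ(M) [q · adj M]_f` for `(n, N) = 1`

Theorems and definitions with bodies only (D-0026). We instantiate the abstract
Hecke-compatibility theorem `PopaZagier.finsum_smul_msym_eq` (Popa–Zagier 2017, Thm. 1 / §5;
Merel 1994, Thm. 2) for the M-symbols `msymbol N q : S₂(Γ₀(N))^∧` of the tree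
(`ModularSymbolsManin`), indexed by `q ∈ SL₂(ℤ)/Γ₀(N) ≅ ℙ¹(ℤ/Nℤ)` with the right action `actP`
of `Gamma0CosetP1`:

* `cuspSym f v = {∞, v₀/v₁}_f` for an integer column `v`, and the symbol family
  `psiF f y v = {∞, k_y v}_f`, `k_y = (sec y)⁻¹` (`symbolFamily_psiF`: homogeneous, and
  `Γ₀(N)`-periods cancel in differences);
* `msymbol_heckeTn_eq_sum`: `[q]_{T_n f} = ∑_{C ∈ R_n} ({∞, C k_q ∞}_f - {∞, C k_q 0}_f)`
  (from `T_n f = ∑_{R_n} f|C`, `HeckeTnGamma0Explicit`);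
* the Hermite-normal-form reparametrisation `C ↦ C'` of `R_n` defined by `C k_q S⁻¹ = h C'`,
  `h ∈ SL₂(ℤ)` (a bijection of `R_n`, `hnfRep_bijOn`), under which the `C`-term above is the
  `C'`-term of the abstract right-hand side (`term_hnfRep`);
* `finsum_smul_msymbol_eq`: for every `ξ : M₂(ℤ) → ℚ` finitely supported on determinant `n`,
  `(n, N) = 1`, satisfying property (A) of Popa–Zagier in orbit form,
  `∑_M ξ(M) [actP q (adj M)]_f = 2 [q]_{T_n f}`.

## References

* [PopaZagier2017] A. A. Popa, D. Zagier, Thm. 1, §5.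
* L. Merel, *Universal Fourier expansions of modular forms*, LNM 1585 (1994), Thm. 2, Prop. 9.
* [CremonaAlgorithms1997] J. E. Cremona, §2.2, §2.4.
-/

noncomputable section

open scoped MatrixGroups ModularForm

open CongruenceSubgroup ModularGroup
open scoped Matrix
open Literature.NumberTheory.Automorphic.PopaZagier

namespace Literature.NumberTheory.EllipticCurves.ModularForms

variable {N : ℕ} (f : CuspForm (Gamma0 N) 2)

/-! ### `{∞, v}` for integer columns -/

/-- `{∞, v₀/v₁}_f` for an integer column `v = (v₀, v₁)ᵀ` (`0` if `v₁ = 0`, the cusp `∞`).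
[cite: CremonaAlgorithms1997, §2.2] -/
def cuspSym (v : Fin 2 → ℤ) : ℂ :=
  if v 1 = 0 then 0 else modularSymbol f ((v 0 : ℚ) / (v 1 : ℚ))

/-- Homogeneity: `{∞, (cv₀)/(cv₁)} = {∞, v₀/v₁}`. [folklore] -/
theorem cuspSym_smul {c : ℤ} (hc : c ≠ 0) (v : Fin 2 → ℤ) : cuspSym f (c • v) = cuspSym f v := by
  unfold cuspSym
  simp only [Pi.smul_apply, smul_eq_mul, mul_eq_zero, hc, false_or]
  split_ifs with h
  · rfl
  · congr 1
    push_cast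
    rw [mul_div_mul_left _ _ (by exact_mod_cast hc)]

/-- `{∞, -v} = {∞, v}`. [folklore] -/
theorem cuspSym_neg (v : Fin 2 → ℤ) : cuspSym f (-v) = cuspSym f v := by
  rw [show -v = (-1 : ℤ) • v by simp, cuspSym_smul f (by norm_num)]

/-- On first columns of `SL₂(ℤ)`, `cuspSym` is `inftySymbol`: `{∞, k e₀} = {∞, k∞}`. [folklore] -/
theorem cuspSym_coe_mulVec_e0 (k : SL(2, ℤ)) :
    cuspSym f ((k : Matrix (Fin 2) (Fin 2) ℤ) *ᵥ e0) = inftySymbol f k := by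
  simp [cuspSym, inftySymbol, mulVec_two, e0]

/-- Every nonzero integer column is `c · (first column of some g ∈ SL₂(ℤ))`, `c ≠ 0`. [folklore] -/
theorem exists_smul_coe_mulVec_e0_eq {v : Fin 2 → ℤ} (hv : v ≠ 0) :
    ∃ (c : ℤ) (g : SL(2, ℤ)), c ≠ 0 ∧ c • ((g : Matrix (Fin 2) (Fin 2) ℤ) *ᵥ e0) = v := by
  have hgcd : 0 < Int.gcd (v 0) (v 1) := by
    rw [Int.gcd_pos_iff]
    by_contra h
    simp only [ne_eq, not_or, not_not] at h
    exact hv (by ext i; fin_cases i <;> simp [h.1, h.2])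
  obtain ⟨g, a, b, hg, hab, ha, hb⟩ := Int.exists_gcd_one' hgcd
  obtain ⟨x, y, hxy⟩ := Int.isCoprime_iff_gcd_eq_one.mpr hab
  refine ⟨g, ⟨!![a, -y; b, x], by rw [Matrix.det_fin_two_of]; linear_combination hxy⟩,
    by exact_mod_cast hg.ne', ?_⟩
  ext i
  fin_cases i
  · simp [e0, ha, mul_comm]
  · simp [e0, hb, mul_comm]

open ParabolicCount (sec coe_sec sec_smul_inv_mul_mem)


variable [NeZero N]

/-- **`Γ₀(N)`-periods**: `{∞, δ v} = {∞, δ ∞} + {∞, v}` for `δ ∈ Γ₀(N)` and a nonzero column `v`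
(the Manin relation at the cusp `v`). [cite: CremonaAlgorithms1997, §2.1] -/
theorem cuspSym_gamma0_mulVec {δ : SL(2, ℤ)} (hδ : δ ∈ Gamma0 N) {v : Fin 2 → ℤ} (hv : v ≠ 0) :
    cuspSym f ((δ : Matrix (Fin 2) (Fin 2) ℤ) *ᵥ v) = cuspSymbol f ⟨δ, hδ⟩ + cuspSym f v := by
  obtain ⟨c, g, hc, rfl⟩ := exists_smul_coe_mulVec_e0_eq hv
  rw [Matrix.mulVec_smul, cuspSym_smul f hc, cuspSym_smul f hc, Matrix.mulVec_mulVec,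
    ← Matrix.SpecialLinearGroup.coe_mul, cuspSym_coe_mulVec_e0, cuspSym_coe_mulVec_e0,
    inftySymbol_mul_of_mem f hδ]

/-! ### The symbol family `ψ_y(v) = {∞, k_y v}`, `k_y = (sec y)⁻¹` -/

/-- `ψ^f_y(v) = {∞, k_y v}_f` with `k_y = s(y)⁻¹` for the tree's section `s` of
`SL₂(ℤ) → SL₂(ℤ)/Γ₀(N)` (so `Γ₀(N) k_y ↔ y`). [cite: PopaZagier2017, §5] -/
def psiF (y : Gamma0Coset N) (v : Fin 2 → ℤ) : ℂ :=
  cuspSym f ((((sec y)⁻¹ : SL(2, ℤ)) : Matrix (Fin 2) (Fin 2) ℤ) *ᵥ v)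

/-- `ψ` at a coset `h⁻¹Γ₀(N)` is `{∞, h v}` up to a constant (a `Γ₀(N)`-period) on nonzero `v`.
[folklore] -/
theorem exists_psiF_coe_inv_eq (h : SL(2, ℤ)) :
    ∃ c : ℂ, ∀ v : Fin 2 → ℤ, v ≠ 0 →
      psiF f (((h⁻¹ : SL(2, ℤ)) : Gamma0Coset N)) v = c + cuspSym f ((h : Matrix (Fin 2) (Fin 2) ℤ) *ᵥ v) := by
  -- `sec (h⁻¹ Γ₀) = h⁻¹ δ'` with `δ' ∈ Γ₀(N)`
  set δ' : SL(2, ℤ) := h * sec (((h⁻¹ : SL(2, ℤ)) : Gamma0Coset N)) with hδ'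
  have hδ'mem : δ' ∈ Gamma0 N := by
    have := (QuotientGroup.eq (s := Gamma0 N)).mp
      (coe_sec (((h⁻¹ : SL(2, ℤ)) : Gamma0Coset N))).symm
    simpa [hδ'] using this
  have hinv : (sec (((h⁻¹ : SL(2, ℤ)) : Gamma0Coset N)))⁻¹ = δ'⁻¹ * h := by
    rw [hδ', _root_.mul_inv_rev, inv_mul_cancel_right]
  refine ⟨cuspSymbol f ⟨δ'⁻¹, inv_mem hδ'mem⟩, fun v hv => ?_⟩
  unfold psiF
  rw [hinv, Matrix.SpecialLinearGroup.coe_mul, ← Matrix.mulVec_mulVec,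
    cuspSym_gamma0_mulVec f (inv_mem hδ'mem)]
  exact mulVec_ne_zero_of_det_ne_zero (by rw [h.det_coe]; exact one_ne_zero) hv

/-- **`ψ^f` is a symbol family** for the action `actP` (homogeneous; `Γ₀(N)`-periods cancel in
differences). [cite: PopaZagier2017, §5] -/
theorem symbolFamily_psiF : SymbolFamily (actP N) (psiF f) where
  smul y c v hc := by
    unfold psiF
    rw [Matrix.mulVec_smul, cuspSym_smul f hc]
  equivar y γ hγ v w hv hw := by
    set γ' : SL(2, ℤ) := ⟨γ, hγ⟩ with hγ'
    have hact : actP N y γ = γ'⁻¹ • y := actP_coe N y γ'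
    -- `k_{γ⁻¹ y} = δ k_y γ` with `δ ∈ Γ₀(N)`
    set δ : SL(2, ℤ) := (sec (γ'⁻¹ • y))⁻¹ * γ'⁻¹ * sec y with hδ
    have hδmem : δ ∈ Gamma0 N := sec_smul_inv_mul_mem γ'⁻¹ y
    have hk : (sec (γ'⁻¹ • y))⁻¹ = δ * (sec y)⁻¹ * γ' := by rw [hδ]; group
    have key : ∀ u : Fin 2 → ℤ, u ≠ 0 →
        psiF f (actP N y γ) u = cuspSymbol f ⟨δ, hδmem⟩ + psiF f y (γ *ᵥ u) := by
      intro u hu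
      unfold psiF
      rw [hact, hk, Matrix.SpecialLinearGroup.coe_mul, Matrix.SpecialLinearGroup.coe_mul,
        Matrix.mul_assoc, ← Matrix.mulVec_mulVec, cuspSym_gamma0_mulVec f hδmem, ← Matrix.mulVec_mulVec]
      exact mulVec_ne_zero_of_det_ne_zero (by
        rw [Matrix.det_mul, ((sec y)⁻¹).det_coe, one_mul]; exact hγ.symm ▸ one_ne_zero) hu
    rw [key v hv, key w hw]
    ring

/-- **The M-symbol of the family is the tree's M-symbol**: `ψ_y(e₀) - ψ_y(e₁) = [y]_f`
(`= {k_y 0, k_y ∞}_f`). [cite: CremonaAlgorithms1997, §2.2] -/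
theorem msym_psiF (y : Gamma0Coset N) : msym (psiF f) y = msymbol N y f := by
  have hy : msymbol N y f = msymbolSL f (sec y)⁻¹ := by
    conv_lhs => rw [← coe_sec y]
    rfl
  rw [hy, msymbolSL, msym, psiF, psiF, cuspSym_coe_mulVec_e0, ← cuspSym_coe_mulVec_e0 f ((sec y)⁻¹ * S),
    Matrix.SpecialLinearGroup.coe_mul, ← Matrix.mulVec_mulVec, ModularGroup.coe_S]
  congr 3
  ext i; fin_cases i <;> simp [mulVec_two, e0, e1]

/-! ### `[q]_{T_n f}` as a sum over `R_n` -/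

/-- `{∞, k∞}_{T_n f} = ∑_{C ∈ R_n} {∞, C k e₀}_f` for `k ∈ SL₂(ℤ)`, `(n, N) = 1`.
[cite: CremonaAlgorithms1997, §2.4] -/
theorem inftySymbol_heckeTn {n : ℕ} (hn : 0 < n) (hnN : n.Coprime N) (k : SL(2, ℤ)) :
    inftySymbol (heckeTnGamma0 N 2 n f) k =
      ∑ C ∈ hermiteReps (n : ℤ), cuspSym f (C *ᵥ ((k : Matrix (Fin 2) (Fin 2) ℤ) *ᵥ e0)) := by
  have hn' : (0 : ℤ) < n := by exact_mod_cast hn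
  unfold inftySymbol
  by_cases hz : k 1 0 = 0
  · rw [if_pos hz]
    refine (Finset.sum_eq_zero fun C hC => ?_).symm
    have hc := ((mem_hermiteReps hn' C).mp hC).1
    simp [cuspSym, mulVec_two, e0, hz, hc]
  · rw [if_neg hz, modularSymbol_heckeTnGamma0 hn hnN, sum_hermiteReps_eq hn]
    refine Finset.sum_congr rfl fun x hx => Finset.sum_congr rfl fun b _ => ?_
    obtain ⟨hx1, -⟩ := Nat.mem_divisorsAntidiagonal.mp hx
    have hd : 0 < x.2 := Nat.pos_of_ne_zero fun h => hn.ne' (by rw [← hx1, h, mul_zero])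
    have hdz : (x.2 : ℤ) * k 1 0 ≠ 0 := mul_ne_zero (by exact_mod_cast hd.ne') hz
    simp only [cuspSym, upperMat, mulVec_two, e0, Matrix.of_apply, Matrix.cons_val',
      Matrix.cons_val_zero, Matrix.cons_val_one, Matrix.cons_val_fin_one, mul_one, mul_zero,
      add_zero, zero_mul, zero_add, hdz, if_false]
    congr 1
    have hz' : ((k 1 0 : ℤ) : ℚ) ≠ 0 := by exact_mod_cast hz
    have hd' : ((x.2 : ℤ) : ℚ) ≠ 0 := by exact_mod_cast hd.ne'
    push_cast
    field_simp

/-- **`[q]_{T_n f} = ∑_{C ∈ R_n} ({∞, C k e₀}_f - {∞, C k e₁}_f)`**, `k = k_q`, `(n, N) = 1`.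
[cite: CremonaAlgorithms1997, §2.4] -/
theorem msymbol_heckeTn_eq_sum {n : ℕ} (hn : 0 < n) (hnN : n.Coprime N) (q : Gamma0Coset N) :
    msymbol N q (heckeTnGamma0 N 2 n f) =
      ∑ C ∈ hermiteReps (n : ℤ),
        (cuspSym f (C *ᵥ ((((sec q)⁻¹ : SL(2, ℤ)) : Matrix (Fin 2) (Fin 2) ℤ) *ᵥ e0)) -
          cuspSym f (C *ᵥ ((((sec q)⁻¹ : SL(2, ℤ)) : Matrix (Fin 2) (Fin 2) ℤ) *ᵥ e1))) := by
  have hy : msymbol N q (heckeTnGamma0 N 2 n f) = msymbolSL (heckeTnGamma0 N 2 n f) (sec q)⁻¹ := by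
    conv_lhs => rw [← coe_sec q]
    rfl
  rw [hy, msymbolSL, inftySymbol_heckeTn f hn hnN, inftySymbol_heckeTn f hn hnN, ← Finset.sum_sub_distrib]
  refine Finset.sum_congr rfl fun C _ => ?_
  congr 3
  rw [Matrix.SpecialLinearGroup.coe_mul, ← Matrix.mulVec_mulVec, ModularGroup.coe_S]
  congr 1
  ext i; fin_cases i <;> simp [mulVec_two, e0, e1]

/-! ### Hermite normal form in an `SL₂(ℤ)`-orbit -/

omit [NeZero N] in
/-- `↑S = matS`. [folklore] -/
theorem coe_S_eq_matS : ((S : SL(2, ℤ)) : Matrix (Fin 2) (Fin 2) ℤ) = matS := by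
  rw [ModularGroup.coe_S]; rfl

omit [NeZero N] in
/-- **Existence of the Hermite normal form**: every integer matrix of determinant `n > 0` is `h C'`
with `h ∈ SL₂(ℤ)` and `C' ∈ R_n` (Mathlib's reduction of fixed-determinant matrices).
[cite: DiamondShurman2005, §5.2 (proof of Prop. 5.2.1)] -/
theorem exists_SL_mul_mem_hermiteReps {n : ℤ} (hn : 0 < n) (A : Matrix (Fin 2) (Fin 2) ℤ)
    (hA : A.det = n) :
    ∃ p : SL(2, ℤ) × Matrix (Fin 2) (Fin 2) ℤ,
      p.2 ∈ hermiteReps n ∧ (p.1 : Matrix (Fin 2) (Fin 2) ℤ) * p.2 = A := by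
  have key : ∀ B : FixedDetMatrix (Fin 2) ℤ n, ∃ g : SL(2, ℤ), g • B ∈ FixedDetMatrices.reps n := by
    intro B
    refine FixedDetMatrices.induction_on (C := fun B => ∃ g : SL(2, ℤ), g • B ∈ FixedDetMatrices.reps n)
      hn.ne' ?_ ?_ ?_
    · intro B h1 h2 h3 h4
      exact ⟨1, by rw [one_smul]; exact ⟨h1, h2, h3, h4⟩⟩
    · rintro B ⟨g, hg⟩
      exact ⟨g * S⁻¹, by rwa [mul_smul, inv_smul_smul]⟩
    · rintro B ⟨g, hg⟩
      exact ⟨g * T⁻¹, by rwa [mul_smul, inv_smul_smul]⟩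
  obtain ⟨g, hg⟩ := key ⟨A, hA⟩
  set B : FixedDetMatrix (Fin 2) ℤ n := g • ⟨A, hA⟩ with hB
  obtain ⟨h1, h2, h3, h4⟩ := hg
  have hdet : B.1.det = n := B.2
  have had : B.1 0 0 * B.1 1 1 = n := by
    have h' := B.2
    rw [Matrix.det_fin_two, h1, mul_zero, sub_zero] at h'
    exact h'
  have hd : 0 < B.1 1 1 := by
    by_contra hd
    rw [not_lt] at hd
    nlinarith
  refine ⟨(g⁻¹, B.1), ?_, ?_⟩
  · rw [mem_hermiteReps hn]
    refine ⟨h1, h2, h3, ?_, hdet⟩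
    rw [abs_of_nonneg h3, abs_of_pos hd] at h4
    exact h4
  · simp only
    rw [hB, FixedDetMatrices.smul_coe, ← Matrix.mul_assoc, ← Matrix.SpecialLinearGroup.coe_mul,
      inv_mul_cancel, Matrix.SpecialLinearGroup.coe_one, Matrix.one_mul]

omit [NeZero N] in
/-- **Uniqueness of the Hermite normal form**: two elements of `R_n` in the same `SL₂(ℤ)`-orbit
are equal. [cite: DiamondShurman2005, §5.2] -/
theorem eq_of_SL_mul_mem_hermiteReps {n : ℤ} (hn : 0 < n) {C D : Matrix (Fin 2) (Fin 2) ℤ}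
    (hC : C ∈ hermiteReps n) (hD : D ∈ hermiteReps n) (γ : SL(2, ℤ))
    (h : (γ : Matrix (Fin 2) (Fin 2) ℤ) * C = D) : C = D := by
  obtain ⟨hc0, ha, hb0, hbd, -⟩ := (mem_hermiteReps hn C).mp hC
  obtain ⟨hc0', ha', hb0', hbd', -⟩ := (mem_hermiteReps hn D).mp hD
  have hdetγ := γ.det_coe
  rw [Matrix.det_fin_two] at hdetγ
  have e00 := congrFun (congrFun h 0) 0
  have e01 := congrFun (congrFun h 0) 1
  have e10 := congrFun (congrFun h 1) 0
  have e11 := congrFun (congrFun h 1) 1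
  simp only [Matrix.mul_apply, Fin.sum_univ_two, hc0, hc0', mul_zero, add_zero] at e00 e01 e10 e11
  -- `γ` is upper triangular with positive diagonal, hence `1` on the diagonal
  have hr : γ 1 0 = 0 := by
    rcases mul_eq_zero.mp e10 with h0 | h0
    · exact h0
    · omega
  rw [hr, mul_zero, sub_zero] at hdetγ
  rw [hr, zero_mul, zero_add] at e11
  have hp : γ 0 0 = 1 := by
    rcases Int.eq_one_or_neg_one_of_mul_eq_one hdetγ with h1 | h1
    · exact h1
    · rw [h1] at e00; omega
  have hs : γ 1 1 = 1 := by rw [hp, one_mul] at hdetγ; exact hdetγ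
  rw [hp, one_mul] at e00 e01
  rw [hs, one_mul] at e11
  -- the shift `b' = b + q d` with both `b, b' ∈ [0, d)` forces `q = 0`
  have hq : γ 0 1 = 0 := by
    rcases lt_trichotomy (γ 0 1) 0 with hneg | h0 | hpos
    · have : γ 0 1 ≤ -1 := by omega
      nlinarith
    · exact h0
    · have : 1 ≤ γ 0 1 := by omega
      nlinarith
  rw [hq, zero_mul, add_zero] at e01
  ext i j
  fin_cases i <;> fin_cases j
  · exact e00
  · exact e01
  · simp [hc0, hc0']
  · exact e11

/-- The Hermite representative `C'` of `C k_q S⁻¹` (`= h C'`), for `det C = n > 0`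
(and `C` itself otherwise). [folklore] -/
def hnfRep {n : ℤ} (hn : 0 < n) (q : Gamma0Coset N) (C : Matrix (Fin 2) (Fin 2) ℤ) :
    Matrix (Fin 2) (Fin 2) ℤ :=
  if hC : C.det = n then
    (Classical.choose (exists_SL_mul_mem_hermiteReps hn
      (C * (((sec q)⁻¹ * S⁻¹ : SL(2, ℤ)) : Matrix (Fin 2) (Fin 2) ℤ))
      (by rw [Matrix.det_mul, Matrix.SpecialLinearGroup.det_coe, mul_one, hC]))).2
  else C

/-- The `SL₂(ℤ)`-part `h` of `C k_q S⁻¹ = h C'`. [folklore] -/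
def hnfSL {n : ℤ} (hn : 0 < n) (q : Gamma0Coset N) (C : Matrix (Fin 2) (Fin 2) ℤ)
    (hC : C.det = n) : SL(2, ℤ) :=
  (Classical.choose (exists_SL_mul_mem_hermiteReps hn
    (C * (((sec q)⁻¹ * S⁻¹ : SL(2, ℤ)) : Matrix (Fin 2) (Fin 2) ℤ))
    (by rw [Matrix.det_mul, Matrix.SpecialLinearGroup.det_coe, mul_one, hC]))).1

omit [NeZero N] in
/-- The defining property `h C' = C k_q S⁻¹`, `C' ∈ R_n`. [folklore] -/
theorem hnfRep_spec {n : ℤ} (hn : 0 < n) (q : Gamma0Coset N) {C : Matrix (Fin 2) (Fin 2) ℤ}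
    (hC : C.det = n) :
    hnfRep hn q C ∈ hermiteReps n ∧
      (hnfSL hn q C hC : Matrix (Fin 2) (Fin 2) ℤ) * hnfRep hn q C =
        C * (((sec q)⁻¹ * S⁻¹ : SL(2, ℤ)) : Matrix (Fin 2) (Fin 2) ℤ) := by
  rw [hnfRep, dif_pos hC]
  exact Classical.choose_spec (exists_SL_mul_mem_hermiteReps hn
    (C * (((sec q)⁻¹ * S⁻¹ : SL(2, ℤ)) : Matrix (Fin 2) (Fin 2) ℤ))
    (by rw [Matrix.det_mul, Matrix.SpecialLinearGroup.det_coe, mul_one, hC]))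

omit [NeZero N] in
/-- **`C ↦ C'` is a bijection of `R_n`** (injective by uniqueness of the normal form: `C'₁ = C'₂`
forces `C₂ = (h₂ h₁⁻¹) C₁`; surjective by counting). [folklore] -/
theorem hnfRep_bijOn {n : ℤ} (hn : 0 < n) (q : Gamma0Coset N) :
    Set.BijOn (hnfRep hn q) (hermiteReps n : Set (Matrix (Fin 2) (Fin 2) ℤ)) (hermiteReps n) := by
  have hmaps : Set.MapsTo (hnfRep hn q) (hermiteReps n : Set (Matrix (Fin 2) (Fin 2) ℤ))
      (hermiteReps n) := fun C hC =>
    (hnfRep_spec hn q (det_of_mem_hermiteReps hn (Finset.mem_coe.mp hC))).1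
  have hinj : Set.InjOn (hnfRep hn q) (hermiteReps n : Set (Matrix (Fin 2) (Fin 2) ℤ)) := by
    intro C₁ h₁ C₂ h₂ heq
    have hd₁ := det_of_mem_hermiteReps hn (Finset.mem_coe.mp h₁)
    have hd₂ := det_of_mem_hermiteReps hn (Finset.mem_coe.mp h₂)
    have s₁ := (hnfRep_spec hn q hd₁).2
    have s₂ := (hnfRep_spec hn q hd₂).2
    rw [← heq] at s₂
    set K : SL(2, ℤ) := (sec q)⁻¹ * S⁻¹ with hK
    set g₁ := hnfSL hn q C₁ hd₁
    set g₂ := hnfSL hn q C₂ hd₂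
    -- `C₂ = (g₂ g₁⁻¹) C₁`
    refine eq_of_SL_mul_mem_hermiteReps hn (Finset.mem_coe.mp h₁) (Finset.mem_coe.mp h₂) (g₂ * g₁⁻¹) ?_
    have h1 : hnfRep hn q C₁ = ((g₁⁻¹ : SL(2, ℤ)) : Matrix (Fin 2) (Fin 2) ℤ) * (C₁ * K) := by
      rw [← s₁, ← Matrix.mul_assoc, ← Matrix.SpecialLinearGroup.coe_mul, inv_mul_cancel,
        Matrix.SpecialLinearGroup.coe_one, Matrix.one_mul]
    have h2 : ((g₂ : SL(2, ℤ)) : Matrix (Fin 2) (Fin 2) ℤ) *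
        (((g₁⁻¹ : SL(2, ℤ)) : Matrix (Fin 2) (Fin 2) ℤ) * (C₁ * K)) *
          ((K⁻¹ : SL(2, ℤ)) : Matrix (Fin 2) (Fin 2) ℤ) =
        C₂ * K * ((K⁻¹ : SL(2, ℤ)) : Matrix (Fin 2) (Fin 2) ℤ) := by
      rw [← h1, s₂]
    rw [Matrix.mul_assoc C₂, ← Matrix.SpecialLinearGroup.coe_mul, mul_inv_cancel,
      Matrix.SpecialLinearGroup.coe_one, Matrix.mul_one] at h2
    rw [← h2, Matrix.SpecialLinearGroup.coe_mul]
    simp only [Matrix.mul_assoc]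
    rw [← Matrix.SpecialLinearGroup.coe_mul K, mul_inv_cancel, Matrix.SpecialLinearGroup.coe_one,
      Matrix.mul_one]
  exact ⟨hmaps, hinj, Finset.surjOn_of_injOn_of_card_le _ hmaps hinj le_rfl⟩

/-! ### The coset and the value of the `C'`-term -/

omit [NeZero N] in
/-- Reduction mod `N` of `firstCol`: `firstCol g = (g e₀) mod N`. [folklore] -/
theorem firstCol_val (g : SL(2, ℤ)) :
    (firstCol N g).1 = fun i => ((((g : Matrix (Fin 2) (Fin 2) ℤ) *ᵥ e0) i : ℤ) : ZMod N) := by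
  ext i; fin_cases i <;> simp [firstCol, mulVec_two, e0]

omit [NeZero N] in
/-- Reduction mod `N` commutes with `*ᵥ`. [folklore] -/
theorem redMat_mulVec_red (B : Matrix (Fin 2) (Fin 2) ℤ) (u : Fin 2 → ℤ) :
    (redMat N B *ᵥ fun i => ((u i : ℤ) : ZMod N)) = fun i => (((B *ᵥ u) i : ℤ) : ZMod N) := by
  ext i
  rw [show (fun i => ((u i : ℤ) : ZMod N)) = (Int.castRingHom (ZMod N)) ∘ u from rfl,
    show (((B *ᵥ u) i : ℤ) : ZMod N) = Int.castRingHom (ZMod N) ((B *ᵥ u) i) from rfl,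
    RingHom.map_mulVec]
  rfl

omit [NeZero N] in
/-- `adj C e₀ = d e₀` for `C = (a b; 0 d)`. [folklore] -/
theorem adjugate_mulVec_e0_of_upper {C : Matrix (Fin 2) (Fin 2) ℤ} (hc : C 1 0 = 0) :
    Matrix.adjugate C *ᵥ e0 = C 1 1 • e0 := by
  rw [Matrix.adjugate_fin_two]
  ext i; fin_cases i <;> simp [mulVec_two, e0, hc]

omit [NeZero N] in
/-- `↑S⁻¹ e₁ = e₀` and `↑S⁻¹ e₀ = -e₁`. [folklore] -/
theorem coe_S_inv_mulVec :
    ((S⁻¹ : SL(2, ℤ)) : Matrix (Fin 2) (Fin 2) ℤ) *ᵥ e1 = e0 ∧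
      ((S⁻¹ : SL(2, ℤ)) : Matrix (Fin 2) (Fin 2) ℤ) *ᵥ e0 = -e1 := by
  rw [Matrix.SpecialLinearGroup.coe_inv, ModularGroup.coe_S, Matrix.adjugate_fin_two]
  constructor <;> (ext i; fin_cases i <;> simp [mulVec_two, e0, e1])

/-- **The coset of the `C'`-term**: if `h C' = C k_q S⁻¹` (`C, C' ∈ R_n`, `(n, N) = 1`) then
`actP (actP q (adj S)) (adj C') = h⁻¹ Γ₀(N)` (in `ℙ¹(ℤ/Nℤ)`: `a · col(h⁻¹) = C' S col(k_q⁻¹)`).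
[cite: PopaZagier2017, §5] -/
theorem actP_actP_eq_coe {n : ℤ} (hn : 0 < n) (hnN : IsUnit ((n : ℤ) : ZMod N)) (q : Gamma0Coset N)
    {C C' : Matrix (Fin 2) (Fin 2) ℤ} (hC : C ∈ hermiteReps n) (hC' : C' ∈ hermiteReps n)
    (h : SL(2, ℤ))
    (hh : (h : Matrix (Fin 2) (Fin 2) ℤ) * C' =
      C * (((sec q)⁻¹ * S⁻¹ : SL(2, ℤ)) : Matrix (Fin 2) (Fin 2) ℤ)) :
    actP N (actP N q (Matrix.adjugate matS)) (Matrix.adjugate C') =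
      ((h⁻¹ : SL(2, ℤ)) : Gamma0Coset N) := by
  obtain ⟨hc0, ha, -, -, hdetC⟩ := (mem_hermiteReps hn C).mp hC
  -- the integer identity `a (h⁻¹ e₀) = C' S k⁻¹ e₀`
  have hd0 : C 1 1 ≠ 0 := by
    intro hd
    rw [Matrix.det_fin_two, hc0, hd] at hdetC
    simp at hdetC
    exact hn.ne' hdetC.symm
  have key : C 0 0 • (((h⁻¹ : SL(2, ℤ)) : Matrix (Fin 2) (Fin 2) ℤ) *ᵥ e0) =
      C' *ᵥ (matS *ᵥ (((sec q : SL(2, ℤ)) : Matrix (Fin 2) (Fin 2) ℤ) *ᵥ e0)) := by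
    set k : SL(2, ℤ) := sec q with hk
    have hinvh : ((h⁻¹ : SL(2, ℤ)) : Matrix (Fin 2) (Fin 2) ℤ) * (h : Matrix (Fin 2) (Fin 2) ℤ) = 1 := by
      rw [← Matrix.SpecialLinearGroup.coe_mul, inv_mul_cancel, Matrix.SpecialLinearGroup.coe_one]
    have hSS : ((S⁻¹ : SL(2, ℤ)) : Matrix (Fin 2) (Fin 2) ℤ) *
        ((S : SL(2, ℤ)) : Matrix (Fin 2) (Fin 2) ℤ) = 1 := by
      rw [← Matrix.SpecialLinearGroup.coe_mul, inv_mul_cancel, Matrix.SpecialLinearGroup.coe_one]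
    -- `C' S = h⁻¹ C k⁻¹`
    have h1 : C' * matS = ((h⁻¹ : SL(2, ℤ)) : Matrix (Fin 2) (Fin 2) ℤ) * C *
        (((k⁻¹ : SL(2, ℤ)) : Matrix (Fin 2) (Fin 2) ℤ)) := by
      calc C' * matS
          = ((h⁻¹ : SL(2, ℤ)) : Matrix (Fin 2) (Fin 2) ℤ) * (h : Matrix (Fin 2) (Fin 2) ℤ) * C' *
              ((S : SL(2, ℤ)) : Matrix (Fin 2) (Fin 2) ℤ) := by
            rw [hinvh, Matrix.one_mul, coe_S_eq_matS]
        _ = ((h⁻¹ : SL(2, ℤ)) : Matrix (Fin 2) (Fin 2) ℤ) * ((h : Matrix (Fin 2) (Fin 2) ℤ) * C') *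
              ((S : SL(2, ℤ)) : Matrix (Fin 2) (Fin 2) ℤ) := by simp only [Matrix.mul_assoc]
        _ = ((h⁻¹ : SL(2, ℤ)) : Matrix (Fin 2) (Fin 2) ℤ) *
              (C * ((((k⁻¹ : SL(2, ℤ)) : Matrix (Fin 2) (Fin 2) ℤ)) *
                ((S⁻¹ : SL(2, ℤ)) : Matrix (Fin 2) (Fin 2) ℤ))) *
              ((S : SL(2, ℤ)) : Matrix (Fin 2) (Fin 2) ℤ) := by
            rw [hh, hk, Matrix.SpecialLinearGroup.coe_mul]
        _ = ((h⁻¹ : SL(2, ℤ)) : Matrix (Fin 2) (Fin 2) ℤ) * C *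
              (((k⁻¹ : SL(2, ℤ)) : Matrix (Fin 2) (Fin 2) ℤ)) *
              (((S⁻¹ : SL(2, ℤ)) : Matrix (Fin 2) (Fin 2) ℤ) *
                ((S : SL(2, ℤ)) : Matrix (Fin 2) (Fin 2) ℤ)) := by
            simp only [Matrix.mul_assoc]
        _ = _ := by rw [hSS, Matrix.mul_one]
    have hkk : ∀ v : Fin 2 → ℤ, (((k⁻¹ : SL(2, ℤ)) : Matrix (Fin 2) (Fin 2) ℤ)) *ᵥ
        (((k : SL(2, ℤ)) : Matrix (Fin 2) (Fin 2) ℤ) *ᵥ v) = v := fun v => by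
      rw [Matrix.mulVec_mulVec, ← Matrix.SpecialLinearGroup.coe_mul, inv_mul_cancel,
        Matrix.SpecialLinearGroup.coe_one, Matrix.one_mulVec]
    -- apply to the vector `k adj(C) e₀ = d · k e₀`
    have hu := congrArg (fun X : Matrix (Fin 2) (Fin 2) ℤ =>
      X *ᵥ ((((k : SL(2, ℤ)) : Matrix (Fin 2) (Fin 2) ℤ)) *ᵥ (Matrix.adjugate C *ᵥ e0))) h1
    simp only [← Matrix.mulVec_mulVec, hkk] at hu
    simp only [adjugate_mulVec_e0_of_upper hc0, Matrix.mulVec_smul,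
      mulVec_e0_of_mem_hermiteReps hn hC] at hu
    -- `hu : d • C' S k e₀ = d • a • h⁻¹ e₀`
    exact (smul_right_injective (Fin 2 → ℤ) hd0 hu).symm
  -- compare classes in `ℙ¹(ℤ/Nℤ)`
  apply (cosetEquivP1 N).injective
  have hq : cosetEquivP1 N q = colP N (sec q) := by
    conv_lhs => rw [← coe_sec q]
    rfl
  have hS : IsUnit (redMat N matS).det := by rw [isUnit_det_redMat_iff, det_matS]; simp
  have hC'u : IsUnit (redMat N C').det := by
    rw [isUnit_det_redMat_iff, det_of_mem_hermiteReps hn hC']; exact hnN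
  rw [cosetEquivP1_actP_adjugate, cosetEquivP1_actP_adjugate, hq, cosetEquivP1_mk, colP, colP,
    smulP1_mk N hS, smulP1_mk N hC'u, P1.mk_eq_mk_iff]
  simp only [UniCol.mulVec, firstCol_val, redMat_mulVec_red]
  rw [← key]
  simp only [Pi.smul_apply, smul_eq_mul, Int.cast_mul]
  ring

/-- **The `C'`-term is the `C`-term**: if `h C' = C k_q S⁻¹` then
`ψ_{y''}(C' e₁) - ψ_{y''}(e₀) = {∞, C k_q e₀} - {∞, C k_q e₁}` for `y'' = actP (actP q (adj S)) (adj C')`.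
[cite: PopaZagier2017, §5] -/
theorem term_hnf {n : ℤ} (hn : 0 < n) (hnN : IsUnit ((n : ℤ) : ZMod N)) (q : Gamma0Coset N)
    {C C' : Matrix (Fin 2) (Fin 2) ℤ} (hC : C ∈ hermiteReps n) (hC' : C' ∈ hermiteReps n)
    (h : SL(2, ℤ))
    (hh : (h : Matrix (Fin 2) (Fin 2) ℤ) * C' =
      C * (((sec q)⁻¹ * S⁻¹ : SL(2, ℤ)) : Matrix (Fin 2) (Fin 2) ℤ)) :
    psiF f (actP N (actP N q (Matrix.adjugate matS)) (Matrix.adjugate C')) (C' *ᵥ e1) -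
        psiF f (actP N (actP N q (Matrix.adjugate matS)) (Matrix.adjugate C')) e0 =
      cuspSym f (C *ᵥ ((((sec q)⁻¹ : SL(2, ℤ)) : Matrix (Fin 2) (Fin 2) ℤ) *ᵥ e0)) -
        cuspSym f (C *ᵥ ((((sec q)⁻¹ : SL(2, ℤ)) : Matrix (Fin 2) (Fin 2) ℤ) *ᵥ e1)) := by
  obtain ⟨hc0', ha', hb0', hbd', -⟩ := (mem_hermiteReps hn C').mp hC'
  rw [actP_actP_eq_coe hn hnN q hC hC' h hh]
  obtain ⟨c, hc⟩ := exists_psiF_coe_inv_eq f h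
  have hCe1 : C' *ᵥ e1 ≠ 0 := fun h0 => by
    have := congrFun h0 1
    simp [mulVec_two, e1] at this
    omega
  rw [hc _ hCe1, hc _ e0_ne_zero, add_sub_add_left_eq_sub]
  -- `h C' e₁ = C k e₀` and `a' (h e₀) = h C' e₀ = -C k e₁`
  have hk := coe_S_inv_mulVec
  have h1 : (h : Matrix (Fin 2) (Fin 2) ℤ) *ᵥ (C' *ᵥ e1) =
      C *ᵥ ((((sec q)⁻¹ : SL(2, ℤ)) : Matrix (Fin 2) (Fin 2) ℤ) *ᵥ e0) := by
    rw [Matrix.mulVec_mulVec, hh, ← Matrix.mulVec_mulVec, Matrix.SpecialLinearGroup.coe_mul,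
      ← Matrix.mulVec_mulVec, hk.1]
  have h2 : C' 0 0 • ((h : Matrix (Fin 2) (Fin 2) ℤ) *ᵥ e0) =
      -(C *ᵥ ((((sec q)⁻¹ : SL(2, ℤ)) : Matrix (Fin 2) (Fin 2) ℤ) *ᵥ e1)) := by
    rw [← Matrix.mulVec_smul, ← mulVec_e0_of_mem_hermiteReps hn hC', Matrix.mulVec_mulVec, hh,
      ← Matrix.mulVec_mulVec, Matrix.SpecialLinearGroup.coe_mul, ← Matrix.mulVec_mulVec, hk.2,
      Matrix.mulVec_neg, Matrix.mulVec_neg]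
  rw [h1, ← cuspSym_smul f ha'.ne' ((h : Matrix (Fin 2) (Fin 2) ℤ) *ᵥ e0), h2, cuspSym_neg]

/-! ### Assembly -/

/-- **The Hecke operators on M-symbols** (Merel 1994, Thm. 2; Popa–Zagier 2017, §5): for
`ξ : M₂(ℤ) → ℚ` finitely supported on matrices of determinant `n`, `(n, N) = 1`, satisfying
property (A) in orbit form, and every `q ∈ SL₂(ℤ)/Γ₀(N)`,
`∑_M ξ(M) [actP q (adj M)]_f = 2 [q]_{T_n f}` for all `f ∈ S₂(Γ₀(N))`.
[cite: PopaZagier2017, Thm. 1, §5] -/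
theorem finsum_smul_msymbol_eq {n : ℕ} (hn : 0 < n) (hnN : n.Coprime N)
    {ξ : Matrix (Fin 2) (Fin 2) ℤ → ℚ}
    (hfin : (Function.support ξ).Finite) (hdet : ∀ M, ξ M ≠ 0 → M.det = n)
    (hA : ∀ M : Matrix (Fin 2) (Fin 2) ℤ, M.det = n →
      orbT (zeta0 ξ) M = (if M 1 0 = 0 then 1 else 0) - (if M 1 1 = 0 then 1 else 0))
    (q : Gamma0Coset N) :
    ∑ᶠ M, ξ M • msymbol N (actP N q (Matrix.adjugate M)) f =
      (2 : ℚ) • msymbol N q (heckeTnGamma0 N 2 n f) := by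
  have hn' : (0 : ℤ) < n := by exact_mod_cast hn
  have hunit : IsUnit (((n : ℤ) : ℤ) : ZMod N) := by
    rw [Int.cast_natCast]; exact (ZMod.isUnit_iff_coprime n N).mpr hnN
  have hgood : ∀ M : Matrix (Fin 2) (Fin 2) ℤ, M.det = n → IsUnit ((M.det : ℤ) : ZMod N) :=
    fun M hM => by rw [hM]; exact hunit
  have key := finsum_smul_msym_eq (cosetAction_actP N) (symbolFamily_psiF f) hn' hfin hdet hgood hA q
  simp only [msym_psiF] at key
  rw [key, msymbol_heckeTn_eq_sum f hn hnN q]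
  congr 1
  symm
  obtain ⟨hmaps, hinj, hsurj⟩ := hnfRep_bijOn (N := N) hn' q
  refine Finset.sum_nbij (hnfRep hn' q) (fun C hC => hmaps (Finset.mem_coe.mpr hC)) hinj hsurj
    fun C hC => ?_
  have hdC := det_of_mem_hermiteReps hn' hC
  obtain ⟨hmem, hh⟩ := hnfRep_spec hn' q hdC
  exact (term_hnf f hn' hunit q hC hmem (hnfSL hn' q C hdC) hh).symm

end Literature.NumberTheory.EllipticCurves.ModularForms
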